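import Literature.AlgebraicGeometry.Resolution.RankOneReductionProofs
import Mathlib.RingTheory.DiscreteValuationRing.Basic
import HarnessLib

/-!
# Rational discrete places admit relative local uniformization (Knaf–Kuhlmann 2009, Thm. 1.5)

Topic: `Literature/AlgebraicGeometry/Resolution`. Sources reproduced (statement level):

* H. Knaf, F.-V. Kuhlmann, *Every place admits local uniformization in a finite extension of
  the function field*, Adv. Math. 221 (2009) 428–453 = arXiv:math/0702856, **Thm. 1.5**
  (numbering of the arXiv version, label `MTdens`, proved in §3.4 there): "Let `(F|K,P)` be a
  valued function field with the property that `(F,P)` lies in the completion of a subfunction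
  field `(F₀,P|F₀)` such that `P|F₀` is an Abhyankar place of `F₀|K`, `vF₀/vK` is torsion-free
  and `F₀P|KP` is separable. If `P|K = id_K`, then `P` is strongly smoothly `K`-uniformizable
  …".
* F.-V. Kuhlmann, *On local uniformization in arbitrary characteristic I*, arXiv:math/9903097
  (1999), **Thm. 1.8 / Cor. 1.9** ("On a function field `F|K`, all rational rank 1 Abhyankar
  places and all rational discrete places are uniformizable") together with the reduction of
  Remark 1 after Thm. 1.12 there, which is how the rational discrete case is an instance of the
  theorem above: for a rational (`FP = K`) discrete (`vF ≅ ℤ`) `K`-trivial place choose `x ∈ F`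
  of smallest positive value; then `P|K(x)` is a rational Abhyankar place of `K(x)|K` (rational
  rank `1` = transcendence degree `1`, residue field `K`), and `F` lies in the completion
  `K((x))` of `(K(x),P)` (the completion of the discretely valued field `F` has uniformizer `x`
  and coefficient field `K = FP`, hence is `K((x))`).

"Strongly (smoothly) `K`-uniformizable" (Knaf–Kuhlmann 2009, §1: for EVERY finite set
`Z ⊆ O_P` there is a model of `F|K` — a separated integral `K`-scheme of finite type with
function field `F` — on which `P` is centred at a regular (smooth) point whose local ring
contains `Z`) implies the relative local-uniformization property `RelLocalUniformization k K O`
of this topic (`RankOneReduction.lean`): given an affine model `R ⊆ O`, take for `Z` a finite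
generating set of `R`; an affine neighbourhood of the centre, localized at finitely many
functions invertible at the centre so as to contain `Z`, is a finitely generated `k`-algebra
`A ⊆ O` containing `R` whose local ring at the centre of `O` is the regular local ring of the
model. We therefore record the theorem, in the rational discrete case, directly in that
language (a faithful weakening, as for `KnafKuhlmann2005_Thm11`).

Contents:
* `IsRationalOver k O` — the residue field of the valuation ring `O ⊇ k` is `k`: every element
  of `O` is congruent to a constant modulo the maximal ideal [folklore];
* `KnafKuhlmann2009RationalDiscrete` — the NAMED FACT: relative local uniformization holds at
  every valuation ring of a finitely generated extension `K/k` which is a discrete valuation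
  ring with residue field `k` (any characteristic, any dimension);
* `relLocalUniformization_of_rankOne_nonRationalDiscrete` — PROVED: granted the fact, relative
  local uniformization over `k` at EVERY valuation ring follows from relative local
  uniformization at the RANK-ONE valuation rings over `k` which are NOT rational discrete
  (Novacoski–Spivakovsky 2014, Thm. 1.1, tree theorem `NovacoskiSpivakovsky2014_holds`, and a
  case distinction); `relLocalUniformization_iff_rankOne_nonRationalDiscrete` — the
  corresponding equivalence.

Use: the rational discrete valuation rings (the "`k`-rational arcs") are thereby removed from
the open core of local uniformization in positive characteristic; see
`MuPTorsorLocalUniformizationRelative.lean` and `ResiduallyAlgebraicReduction.lean` for the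
complementary reductions (rank one, residually algebraic, core `μ_p`-torsor steps).
-/

noncomputable section

namespace Literature.AlgebraicGeometry.Resolution

variable {k K : Type} [Field k] [Field K] [Algebra k K]

/-- The valuation ring `O` of `K ⊇ k` is RATIONAL over `k`: every element of `O` is congruent
to a constant of `k` modulo the maximal ideal of `O`, i.e. the residue field of `O` is the
image of `k`. [folklore] -/
def IsRationalOver (k : Type) {K : Type} [Field k] [Field K] [Algebra k K]
    (O : ValuationSubring K) : Prop :=
  ∀ t ∈ O, ∃ c : k, O.valuation (t - algebraMap k K c) < 1

/-- In a rational valuation ring the residue of every element is the residue of a constant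
(restatement of the definition through the maximal ideal). [folklore] -/
theorem IsRationalOver.exists_sub_mem_maximalIdeal {O : ValuationSubring K}
    (h : IsRationalOver k O) (hk : ∀ c : k, algebraMap k K c ∈ O) (t : O) :
    ∃ c : k, t - ⟨algebraMap k K c, hk c⟩ ∈ IsLocalRing.maximalIdeal O := by
  obtain ⟨c, hc⟩ := h t t.2
  refine ⟨c, (O.valuation_lt_one_iff _).mpr ?_⟩
  simpa using hc

/-- NAMED FACT — **Knaf–Kuhlmann 2009, Thm. 1.5, rational discrete case** (= Kuhlmann 1999,
Thm. 1.8 / Cor. 1.9: "all rational discrete places are uniformizable", in the strong form "with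
respect to every finite set `Z ⊆ O_P`"), in the language of this topic: for a finitely
generated field extension `K/k` and a valuation ring `O` of `K` containing `k` which is a
DISCRETE VALUATION RING with residue field `k`, every affine model of `K` inside `O` is
dominated by an affine model inside `O` that is regular at the centre of `O`. Any
characteristic, any transcendence degree. Users take `(h : KnafKuhlmann2009RationalDiscrete)`.
[cite: KnafKuhlmann2009, Thm. 1.5] [cite: Kuhlmann1999, Thm. 1.8, Cor. 1.9, Rem. 1] -/
def KnafKuhlmann2009RationalDiscrete : Prop :=
  ∀ (k K : Type) [Field k] [Field K] [Algebra k K], (⊤ : IntermediateField k K).FG →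
    ∀ O : ValuationSubring K, (∀ c : k, algebraMap k K c ∈ O) →
      IsDiscreteValuationRing O → IsRationalOver k O → RelLocalUniformization k K O

/-- `K = k(s)` for the generators `s` of any affine model (local copy of the folklore lemma
`fg_top_of_model` of `MuPTorsorLocalUniformizationRelative.lean`, to keep this file's imports
minimal). [folklore] -/
private theorem fg_top_of_model' (R : Subalgebra k K) (hfg : R.FG) (hfr : IsFractionRing R K) :
    (⊤ : IntermediateField k K).FG := by
  obtain ⟨s, hs⟩ := hfg
  refine ⟨s, eq_top_iff.mpr fun x _ => ?_⟩
  haveI := hfr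
  obtain ⟨a, b, -, rfl⟩ := IsFractionRing.div_surjective (A := R) x
  have hle : R ≤ (IntermediateField.adjoin k (s : Set K)).toSubalgebra := by
    rw [← hs]
    exact IntermediateField.algebra_adjoin_le_adjoin k _
  exact div_mem (hle a.2) (hle b.2)

/-- **Relative local uniformization over `k` reduces to the rank-one valuation rings that are
not rational discrete.** Granted Knaf–Kuhlmann 2009 Thm. 1.5 (rational discrete case): if
relative local uniformization holds at every RANK-ONE valuation ring `O ⊇ k` of every finitely
generated `K/k` which is NOT a discrete valuation ring with residue field `k`, then it holds at
every valuation ring over `k` (Novacoski–Spivakovsky 2014, Thm. 1.1 — tree theorem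
`NovacoskiSpivakovsky2014_holds` — and a case distinction at rank one).
[cite: KnafKuhlmann2009, Thm. 1.5] [cite: NovacoskiSpivakovsky2014, Thm. 1.1] -/
theorem relLocalUniformization_of_rankOne_nonRationalDiscrete
    (hKK : KnafKuhlmann2009RationalDiscrete) {k : Type} [Field k]
    (H : ∀ (K : Type) [Field K] [Algebra k K], (⊤ : IntermediateField k K).FG →
      ∀ O : ValuationSubring K, Nonempty O.valuation.RankOne →
        (∀ c : k, algebraMap k K c ∈ O) → ¬ (IsDiscreteValuationRing O ∧ IsRationalOver k O) →
          RelLocalUniformization k K O)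
    (K : Type) [Field K] [Algebra k K] (O : ValuationSubring K) :
    RelLocalUniformization k K O := by
  classical
  refine NovacoskiSpivakovsky2014_holds k (fun K _ _ O hr => ?_) K O
  intro R hR hfrac hRO
  have hk : ∀ c : k, algebraMap k K c ∈ O := fun c => hRO (R.algebraMap_mem c)
  have hfg := fg_top_of_model' R hR hfrac
  by_cases h : IsDiscreteValuationRing O ∧ IsRationalOver k O
  · exact hKK k K hfg O hk h.1 h.2 R hR hfrac hRO
  · exact H K hfg O hr hk h R hR hfrac hRO

/-- **The equivalence.** Granted Knaf–Kuhlmann 2009 Thm. 1.5 (rational discrete case), relative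
local uniformization at all valuation rings over `k` is EQUIVALENT to relative local
uniformization at the rank-one valuation rings over `k` (of finitely generated extensions,
containing `k`) which are not rational discrete.
[cite: KnafKuhlmann2009, Thm. 1.5] [cite: NovacoskiSpivakovsky2014, Thm. 1.1] -/
theorem relLocalUniformization_iff_rankOne_nonRationalDiscrete
    (hKK : KnafKuhlmann2009RationalDiscrete) {k : Type} [Field k] :
    (∀ (K : Type) [Field K] [Algebra k K] (O : ValuationSubring K),
        RelLocalUniformization k K O) ↔
      ∀ (K : Type) [Field K] [Algebra k K], (⊤ : IntermediateField k K).FG →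
        ∀ O : ValuationSubring K, Nonempty O.valuation.RankOne →
          (∀ c : k, algebraMap k K c ∈ O) →
            ¬ (IsDiscreteValuationRing O ∧ IsRationalOver k O) → RelLocalUniformization k K O :=
  ⟨fun h K _ _ _ O _ _ _ => h K O,
    fun H K _ _ O => relLocalUniformization_of_rankOne_nonRationalDiscrete hKK H K O⟩

end Literature.AlgebraicGeometry.Resolution

end
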